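import Literature.Probability.Distributions.CharFunInversionSmoothing
import HarnessLib

/-!
# Fourier inversion for finite measures, II: `μ = (𝓕⁻ μ̂) · Lebesgue`

Sequel of `CharFunInversionSmoothing.lean` (same setting: `μ` a finite Borel measure on a
finite-dimensional real inner product space `V`, `μ̂ = fourierMeasure μ`, `g_c = gaussSmooth μ c`,
`f_μ = fourierDensity μ`). Main results:

* `integral_mul_fourierDensity` — for `h` continuous with compact support,
  `∫ h f_μ dv = ∫ h dμ`: both are the limit of `∫ h g_c` as `c → ∞`
  (`tendsto_integral_mul_gaussSmooth`: Fubini, the heat kernel as approximate identity via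
  Mathlib's `Real.tendsto_integral_gaussian_smul'`, dominated convergence against `μ`;
  `tendsto_integral_mul_gaussSmooth'`: dominated convergence on `V` with bound `|h|‖μ̂‖₁`).
* `eq_withDensity_fourierDensity` — **the inversion theorem**: if `μ̂ ∈ L¹` then
  `μ = volume.withDensity (ENNReal.ofReal ∘ f_μ)`; radial cutoffs upgrade compactly supported to
  bounded continuous test functions, which determine finite Borel measures
  (`ext_of_forall_integral_eq_of_IsFiniteMeasure`);
  `eq_withDensity_fourierDensity_of_integrable_charFun` is the same with the hypothesis
  `Integrable (charFun μ)`.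
* `fourierDensity_eq_integral_charFun`, `fourierDensity_zero` — the density in the probabilists'
  normalisation, `f_μ(v) = (2π)^{−d} Re ∫ e^{−i⟪t,v⟫} charFun μ (t) dt`, in particular
  `f_μ(0) = (2π)^{−d} ∫ Re charFun μ`.

## References

* R. Durrett, *Probability: Theory and Examples* (4th ed.), Thm. 3.3.14; W. Feller, *An
  Introduction to Probability Theory and its Applications* II, XV.3 (folklore in dimension `d`).
-/

noncomputable section

open _root_.MeasureTheory _root_.Filter _root_.Complex _root_.Real _root_.Module _root_.Set
open scoped Topology FourierTransform RealInnerProductSpace ENNReal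

namespace Literature.Probability.Distributions

variable {V : Type*} [NormedAddCommGroup V] [InnerProductSpace ℝ V] [MeasurableSpace V]
  [BorelSpace V] [FiniteDimensional ℝ V] {μ : Measure V}

/-! ## Testing against compactly supported continuous functions -/

omit [MeasurableSpace V] [BorelSpace V] [FiniteDimensional ℝ V] in
/-- Joint continuity of `(x, v) ↦ h(v) K_c(v − x)`. [folklore] -/
private theorem continuous_mul_gaussKernel_sub {h : V → ℝ} (hh : Continuous h) (c : ℝ) :
    Continuous (Function.uncurry fun x v : V => h v * gaussKernel c (v - x)) :=
  (hh.comp continuous_snd).mul ((continuous_gaussKernel c).comp (continuous_snd.sub continuous_fst))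

/-- `(v, x) ↦ h(v) K_c(v − x)` is integrable on `Lebesgue × μ` for bounded (compactly supported
continuous) `h`. [folklore] -/
theorem integrable_mul_gaussKernel_prod [IsFiniteMeasure μ] {h : V → ℝ} (hh : Continuous h)
    (hsupp : HasCompactSupport h) {c : ℝ} (hc : 0 < c) :
    Integrable (Function.uncurry fun v x : V => h v * gaussKernel c (v - x)) (volume.prod μ) := by
  obtain ⟨C, hC⟩ := hsupp.exists_bound_of_continuous hh
  refine Integrable.mono' (((integrable_uncurry_gaussKernel hc).norm).const_mul C)
    ((hh.comp continuous_fst).mul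
      ((continuous_gaussKernel c).comp (continuous_fst.sub continuous_snd))).aestronglyMeasurable
    (Eventually.of_forall fun p => ?_)
  rcases p with ⟨v, x⟩
  simp only [Function.uncurry_apply_pair, norm_mul, Real.norm_eq_abs,
    abs_of_nonneg (gaussKernel_nonneg hc.le _)]
  exact mul_le_mul_of_nonneg_right (hC v) (gaussKernel_nonneg hc.le _)

/-- The inner convergence: `∫ h(v) K_c(v − x) dv → h(x)` (the heat kernel is an approximate
identity; Mathlib's `Real.tendsto_integral_gaussian_smul'`). [folklore] -/
theorem tendsto_integral_mul_gaussKernel {h : V → ℝ} (hh : Continuous h)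
    (hsupp : HasCompactSupport h) (x : V) :
    Tendsto (fun c : ℝ => ∫ v, h v * gaussKernel c (v - x)) atTop (𝓝 (h x)) := by
  have hint : Integrable (fun v => (h v : ℂ)) :=
    (Complex.continuous_ofReal.comp hh).integrable_of_hasCompactSupport
      (hsupp.comp_left Complex.ofReal_zero)
  have T := Real.tendsto_integral_gaussian_smul' hint (v := x)
    (Complex.continuous_ofReal.comp hh).continuousAt
  have T' : Tendsto (fun c : ℝ => ((∫ v, h v * gaussKernel c (v - x) : ℝ) : ℂ)) atTop
      (𝓝 (h x : ℂ)) := by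
    refine T.congr' ?_
    filter_upwards [Ioi_mem_atTop 0] with c (hc : 0 < c)
    rw [show ((∫ v, h v * gaussKernel c (v - x) : ℝ) : ℂ) =
      ∫ v, ((h v * gaussKernel c (v - x) : ℝ) : ℂ) from integral_ofReal.symm]
    congr 1 with w
    rw [smul_eq_mul, Complex.ofReal_mul, ofReal_gaussKernel hc, norm_sub_rev]
    ring
  have h2 := (Complex.continuous_re.tendsto _).comp T'
  simp only [Function.comp_def, Complex.ofReal_re] at h2
  exact h2

/-- **`∫ h g_c → ∫ h dμ`** for `h` continuous with compact support (Fubini, the approximate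
identity, dominated convergence against the finite measure `μ`). [folklore] -/
theorem tendsto_integral_mul_gaussSmooth [IsFiniteMeasure μ] {h : V → ℝ} (hh : Continuous h)
    (hsupp : HasCompactSupport h) :
    Tendsto (fun c : ℝ => ∫ v, h v * gaussSmooth μ c v) atTop (𝓝 (∫ x, h x ∂μ)) := by
  obtain ⟨C, hC⟩ := hsupp.exists_bound_of_continuous hh
  have hC0 : 0 ≤ C := (norm_nonneg _).trans (hC 0)
  have hswap : ∀ c : ℝ, 0 < c →
      ∫ v, h v * gaussSmooth μ c v = ∫ x, (∫ v, h v * gaussKernel c (v - x)) ∂μ := by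
    intro c hc
    unfold gaussSmooth
    simp_rw [← integral_const_mul]
    exact integral_integral_swap (integrable_mul_gaussKernel_prod hh hsupp hc)
  have hev : (fun c : ℝ => ∫ v, h v * gaussSmooth μ c v) =ᶠ[atTop]
      fun c => ∫ x, (∫ v, h v * gaussKernel c (v - x)) ∂μ := by
    filter_upwards [Ioi_mem_atTop 0] with c (hc : 0 < c); exact hswap c hc
  rw [tendsto_congr' hev]
  refine tendsto_integral_filter_of_dominated_convergence (fun _ => C) ?_ ?_ (integrable_const C)
    (Eventually.of_forall fun x => tendsto_integral_mul_gaussKernel hh hsupp x)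
  · exact Eventually.of_forall fun c =>
      ((continuous_mul_gaussKernel_sub hh c).stronglyMeasurable.integral_prod_right'
        (ν := volume)).aestronglyMeasurable
  · filter_upwards [Ioi_mem_atTop 0] with c (hc : 0 < c)
    refine Eventually.of_forall fun x => ?_
    calc ‖∫ v, h v * gaussKernel c (v - x)‖ ≤ ∫ v, ‖h v * gaussKernel c (v - x)‖ :=
          norm_integral_le_integral_norm _
      _ ≤ ∫ v, C * gaussKernel c (v - x) := by
          refine integral_mono_of_nonneg (Eventually.of_forall fun v => norm_nonneg _)
            (((integrable_gaussKernel hc).comp_sub_right x).const_mul C)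
            (Eventually.of_forall fun v => ?_)
          dsimp only
          rw [norm_mul, Real.norm_eq_abs, Real.norm_eq_abs,
            abs_of_nonneg (gaussKernel_nonneg hc.le _)]
          exact mul_le_mul_of_nonneg_right (hC v) (gaussKernel_nonneg hc.le _)
      _ = C := by
          rw [integral_const_mul, integral_sub_right_eq_self (gaussKernel c) x,
            integral_gaussKernel hc, mul_one]

/-- **`∫ h g_c → ∫ h f_μ`** for `h` continuous with compact support (dominated convergence on
`V`, bound `|h| ‖μ̂‖₁`). [folklore] -/
theorem tendsto_integral_mul_gaussSmooth' [IsFiniteMeasure μ] (hμ : Integrable (fourierMeasure μ))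
    {h : V → ℝ} (hh : Continuous h) (hsupp : HasCompactSupport h) :
    Tendsto (fun c : ℝ => ∫ v, h v * gaussSmooth μ c v) atTop
      (𝓝 (∫ v, h v * fourierDensity μ v)) := by
  refine tendsto_integral_filter_of_dominated_convergence
    (fun v => ‖h v‖ * ∫ w, ‖fourierMeasure μ w‖) ?_ ?_
    ((hh.integrable_of_hasCompactSupport hsupp).norm.mul_const _)
    (Eventually.of_forall fun v => (tendsto_gaussSmooth_fourierDensity hμ v).const_mul (h v))
  · filter_upwards [Ioi_mem_atTop 0] with c (hc : 0 < c)
    exact (hh.mul (continuous_gaussSmooth hc.le)).aestronglyMeasurable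
  · filter_upwards [Ioi_mem_atTop 0] with c (hc : 0 < c)
    refine Eventually.of_forall fun v => ?_
    rw [norm_mul, Real.norm_of_nonneg (gaussSmooth_nonneg hc.le v)]
    exact mul_le_mul_of_nonneg_left (gaussSmooth_le_integral_norm hμ hc v) (norm_nonneg _)

/-- **`∫ h f_μ dv = ∫ h dμ`** for every continuous compactly supported `h`. [folklore] -/
theorem integral_mul_fourierDensity [IsFiniteMeasure μ] (hμ : Integrable (fourierMeasure μ))
    {h : V → ℝ} (hh : Continuous h) (hsupp : HasCompactSupport h) :
    ∫ v, h v * fourierDensity μ v = ∫ x, h x ∂μ :=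
  tendsto_nhds_unique (tendsto_integral_mul_gaussSmooth' hμ hh hsupp)
    (tendsto_integral_mul_gaussSmooth hh hsupp)

/-! ## The inversion theorem -/

/-- Radial cutoffs: `χ_n(v) = max(0, min(1, n + 1 − ‖v‖))`. [folklore] -/
private def cutoff (n : ℕ) (v : V) : ℝ := max 0 (min 1 ((n : ℝ) + 1 - ‖v‖))

omit [InnerProductSpace ℝ V] [MeasurableSpace V] [BorelSpace V] [FiniteDimensional ℝ V] in
/-- `χ_n` is continuous. [folklore] -/
private theorem continuous_cutoff (n : ℕ) : Continuous (cutoff (V := V) n) := by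
  unfold cutoff; fun_prop

omit [InnerProductSpace ℝ V] [MeasurableSpace V] [BorelSpace V] [FiniteDimensional ℝ V] in
/-- `χ_n ≥ 0`. [folklore] -/
private theorem cutoff_nonneg (n : ℕ) (v : V) : 0 ≤ cutoff n v := le_max_left _ _

omit [InnerProductSpace ℝ V] [MeasurableSpace V] [BorelSpace V] [FiniteDimensional ℝ V] in
/-- `χ_n ≤ 1`. [folklore] -/
private theorem cutoff_le_one (n : ℕ) (v : V) : cutoff n v ≤ 1 :=
  max_le zero_le_one (min_le_left _ _)

omit [MeasurableSpace V] [BorelSpace V] in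
/-- `χ_n` is supported in the closed ball of radius `n + 1` (compact: `V` is finite-dimensional).
[folklore] -/
private theorem hasCompactSupport_cutoff (n : ℕ) : HasCompactSupport (cutoff (V := V) n) := by
  refine HasCompactSupport.intro (isCompact_closedBall (0 : V) ((n : ℝ) + 1)) fun v hv => ?_
  rw [Metric.mem_closedBall, dist_zero_right, not_le] at hv
  unfold cutoff
  rw [max_eq_left]
  exact (min_le_right _ _).trans (by linarith)

omit [InnerProductSpace ℝ V] [MeasurableSpace V] [BorelSpace V] [FiniteDimensional ℝ V] in
/-- `χ_n(v) = 1` as soon as `n ≥ ‖v‖`; in particular `χ_n → 1` pointwise. [folklore] -/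
private theorem tendsto_cutoff (v : V) : Tendsto (fun n => cutoff n v) atTop (𝓝 1) := by
  refine tendsto_const_nhds.congr' ?_
  filter_upwards [Filter.eventually_ge_atTop ⌈‖v‖⌉₊] with n hn
  have hn' : ‖v‖ ≤ n := (Nat.le_ceil _).trans (by exact_mod_cast hn)
  unfold cutoff
  rw [min_eq_left (by linarith), max_eq_right zero_le_one]

/-- **Fourier inversion for finite measures (Lévy's inversion theorem, density form).** If `μ` is
a finite Borel measure on a finite-dimensional real inner product space whose Fourier transform
`μ̂` (equivalently, whose characteristic function) is Lebesgue-integrable, then `μ` is absolutely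
continuous with the continuous, non-negative, integrable density
`f_μ(v) = Re ∫ e^{2πi⟪w,v⟫} μ̂(w) dw`: `μ = f_μ · Lebesgue`. Proof: Gaussian smoothing
`g_c = K_c ∗ μ`
has Fourier-side expression `∫ e^{−‖w‖²/c + 2πi⟪v,w⟫} μ̂(w) dw → f_μ(v)`; tested against
`h ∈ C_c`, `∫ h g_c → ∫ h dμ` and `→ ∫ h f_μ`; radial cutoffs upgrade `C_c` to `C_b`, and finite
Borel measures are determined by `C_b`. [folklore] -/
theorem eq_withDensity_fourierDensity [IsFiniteMeasure μ] (hμ : Integrable (fourierMeasure μ)) :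
    μ = volume.withDensity (fun v => ENNReal.ofReal (fourierDensity μ v)) := by
  haveI : IsFiniteMeasure (volume.withDensity fun v => ENNReal.ofReal (fourierDensity μ v)) :=
    isFiniteMeasure_withDensity_ofReal (integrable_fourierDensity hμ).2
  have hνint : ∀ g : V → ℝ, ∫ v, g v ∂(volume.withDensity fun v => ENNReal.ofReal
      (fourierDensity μ v)) = ∫ v, g v * fourierDensity μ v := by
    intro g
    have hm : Measurable fun v => (fourierDensity μ v).toNNReal :=
      (continuous_fourierDensity hμ).measurable.real_toNNReal
    have := integral_withDensity_eq_integral_smul (μ := volume) hm g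
    rw [show (volume.withDensity fun v => ENNReal.ofReal (fourierDensity μ v)) =
      volume.withDensity (fun v => ((fourierDensity μ v).toNNReal : ℝ≥0∞)) from rfl, this]
    congr 1 with v
    rw [NNReal.smul_def, Real.coe_toNNReal _ (fourierDensity_nonneg hμ v), smul_eq_mul, mul_comm]
  apply ext_of_forall_integral_eq_of_IsFiniteMeasure
  intro f
  rw [hνint]
  have hfb : ∀ x, ‖f x‖ ≤ ‖f‖ := fun x => f.norm_coe_le_norm x
  -- the identity for the truncations `f χ_n`
  have hn : ∀ n : ℕ, ∫ x, f x * cutoff n x ∂μ = ∫ v, (f v * cutoff n v) * fourierDensity μ v :=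
    fun n => (integral_mul_fourierDensity hμ (f.continuous.mul (continuous_cutoff n))
      ((hasCompactSupport_cutoff n).mul_left)).symm
  have L1 : Tendsto (fun n : ℕ => ∫ x, f x * cutoff n x ∂μ) atTop (𝓝 (∫ x, f x ∂μ)) := by
    refine tendsto_integral_of_dominated_convergence (fun _ => ‖f‖)
      (fun n => (f.continuous.mul (continuous_cutoff n)).aestronglyMeasurable)
      (integrable_const _) (fun n => Eventually.of_forall fun x => ?_)
      (Eventually.of_forall fun x => by
        simpa using (tendsto_cutoff x).const_mul (f x))
    rw [norm_mul, Real.norm_of_nonneg (cutoff_nonneg n x)]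
    exact (mul_le_of_le_one_right (norm_nonneg _) (cutoff_le_one n x)).trans (hfb x)
  have L2 : Tendsto (fun n : ℕ => ∫ v, (f v * cutoff n v) * fourierDensity μ v) atTop
      (𝓝 (∫ v, f v * fourierDensity μ v)) := by
    refine tendsto_integral_of_dominated_convergence (fun v => ‖f‖ * fourierDensity μ v)
      (fun n => ((f.continuous.mul (continuous_cutoff n)).mul
        (continuous_fourierDensity hμ)).aestronglyMeasurable)
      ((integrable_fourierDensity hμ).const_mul _) (fun n => Eventually.of_forall fun v => ?_)
      (Eventually.of_forall fun v => by
        simpa using ((tendsto_cutoff v).const_mul (f v)).mul_const (fourierDensity μ v))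
    rw [norm_mul, norm_mul, Real.norm_of_nonneg (cutoff_nonneg n v),
      Real.norm_of_nonneg (fourierDensity_nonneg hμ v)]
    exact mul_le_mul_of_nonneg_right
      ((mul_le_of_le_one_right (norm_nonneg _) (cutoff_le_one n v)).trans (hfb v))
      (fourierDensity_nonneg hμ v)
  simp_rw [hn] at L1
  exact tendsto_nhds_unique L1 L2

/-- The inversion theorem with the probabilists' hypothesis `charFun μ ∈ L¹`. [folklore] -/
theorem eq_withDensity_fourierDensity_of_integrable_charFun [IsFiniteMeasure μ]
    (hμ : Integrable (charFun μ)) :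
    μ = volume.withDensity (fun v => ENNReal.ofReal (fourierDensity μ v)) :=
  eq_withDensity_fourierDensity (integrable_charFun_iff.1 hμ)

/-- The density in terms of the characteristic function:
`f_μ(v) = (2π)^{−d} Re ∫ e^{−i⟪t,v⟫} charFun μ (t) dt`. [folklore] -/
theorem fourierDensity_eq_integral_charFun (μ : Measure V) (v : V) :
    fourierDensity μ v =
      ((2 * π) ^ finrank ℝ V)⁻¹ * (∫ t, cexp (-(⟪t, v⟫ : ℝ) * I) * charFun μ t).re := by
  unfold fourierDensity
  rw [Real.fourierInv_eq]
  have h1 : (fun w : V => 𝐞 ⟪w, v⟫ • fourierMeasure μ w) =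
      fun w : V => (fun t : V => cexp (-(⟪t, v⟫ : ℝ) * I) * charFun μ t) ((-(2 * π)) • w) := by
    funext w
    simp only [fourierMeasure_eq_charFun, Circle.smul_def, Real.fourierChar_apply, smul_eq_mul,
      real_inner_smul_left]
    congr 1
    congr 1
    push_cast
    ring
  rw [h1, Measure.integral_comp_smul (μ := volume)
    (fun t : V => cexp (-(⟪t, v⟫ : ℝ) * I) * charFun μ t) (-(2 * π))]
  rw [show |((-(2 * π)) ^ finrank ℝ V)⁻¹| = ((2 * π) ^ finrank ℝ V)⁻¹ by
    rw [abs_inv, abs_pow, abs_neg, abs_of_pos (by positivity : (0 : ℝ) < 2 * π)],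
    Complex.real_smul, Complex.re_ofReal_mul]

/-- In particular at the origin: `f_μ(0) = (2π)^{−d} ∫ Re (charFun μ)`. [folklore] -/
theorem fourierDensity_zero (hμ : Integrable (charFun μ)) :
    fourierDensity μ 0 = ((2 * π) ^ finrank ℝ V)⁻¹ * ∫ t, (charFun μ t).re := by
  rw [fourierDensity_eq_integral_charFun]
  simp only [inner_zero_right, Complex.ofReal_zero, neg_zero, zero_mul, Complex.exp_zero,
    one_mul]
  have h := integral_re hμ
  simp only [RCLike.re_to_complex] at h
  rw [h]

end Literature.Probability.Distributions

end
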